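import Summits.Ventures.HSemireg.WedgeHankelRecurrenceGaussChebyshevSineProductQuarter
import Literature.Algebra.Polynomial.RootDragging

/-!
# Venture HSemireg — **THE COSECANT-SQUARE SUM VIA `C_n`: `∑_{j=1}^{n−1} 1∕(2 − 2cos(2πj∕n)) = (n² − 1)∕12`** (`n ≥ 1`; `= ¼ ∑ 1∕sin²(πj∕n)`) by the logarithmic derivative of
# `Q = ∏_{j=1}^{n−1} (X − 2cos(2πj∕n)) = (C_n − 2)∕(X − 2)` at `X = 2`: `Q(2) = C_n'(2) = n²`, `2Q'(2) = C_n''(2) = n²(n² − 1)∕6` (via `C_n' = nS_{n−1}` (N510) and `6 S_m'(2) = 3 U_m'(1) = m(m+1)(m+2)`)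

HONEST FRAMING. Part of the Lean index of the computation cell `pub-hsemireg` (seat p10 gen 49, Sunday typer «UNIFORM-IN-n»).  Real polynomial calculus and trigonometry only (Mathlib
`Polynomial.derivative`, `Polynomial.Chebyshev.C ∕ S ∕ U`, `Real.sin ∕ cos`); no variety, no cohomology theory, no sheaf, no Ext group and no semiregularity map is constructed here; nothing here says
that HC / HC_CM / HC_AV holds; no Literature fact (unproved `Prop`) is declared or used.  Custodian versions as in `WedgeHankelSiegelIdeal` (1/3).
SOURCES (cited).  I. S. Gradshteyn, I. M. Ryzhik, *Table of Integrals, Series, and Products*, 1.382 (finite sums of `csc²`); T. M. Apostol, *Mathematical Analysis* / the elementary proof of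
`ζ(2) = π²∕6` via `∑_{k=1}^{m} cot²(kπ∕(2m+1)) = m(2m−1)∕3` (A. M. Yaglom, I. M. Yaglom, *Challenging Mathematical Problems* II, Problem 145); T. J. Rivlin, *The Chebyshev Polynomials* (1974), (1.97)–(1.98)
(`T_n'(1) = n²`, `U_n'(1)`); Mathlib `Polynomial.Chebyshev.derivative_U_eval_one`.
PROOF TYPED HERE.  (1) `Q'(x) = Q(x) ∑ 1∕(x − r_j)` for `Q = ∏ (X − r_j)`, `x ∉ {r_j}` — REUSED from `Literature.Algebra.Polynomial.RootDragging.eval_derivative_prod_X_sub_C` (Prasolov (1)); (2) `p = (X − a)q ⇒ p'(a) = q(a)`, `p''(a) = 2q'(a)`;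
(3) `6 S_m'(2) = m(m+1)(m+2)` from Mathlib `derivative_U_eval_one` through `S_m(2x) = U_m(x)` (`derivative_comp`); (4) `6 C_n''(2) = n²(n² − 1)` from N510 `chebyshevC_derivative_eq_S`; (5) assemble on
N508's factorisation and convert `2 − 2cos 2α = 4sin² α`.
DEDUP DISCLOSURE (`rg -n 'csc|inv_sin_sq|sum_inv|eval_derivative_prod' Summits Literature`, `lean search`, 2026-09-04): THE COSECANT SUM ITSELF IS IN THE TREE —
`Literature.Analysis.Quadrature.PolynomialLatticeDiscrepancy.sum_inv_sin_sq_eq` (Dick–Pillichshammer Cor. A.23, `∑_{κ ∈ [1,b)} 1∕sin²(πκ∕b) = (b²−1)∕3`, by finite Parseval) — CITED, NOT RESTATED: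
this file types only the Chebyshev-side statement in the `2 − 2cos(2πj∕n)` normalisation and the derivative identities that produce it; the logarithmic-derivative lemma is REUSED from
`Literature.Algebra.Polynomial.RootDragging` (imported); Mathlib has `derivative_U_eval_one` but neither `S_m'(2)` nor `C_n''(2)`; 0 hits for the 5 names below.

WHAT IS IN THE TREE.  N508 `chebyshevC_sub_two_eq_prod_cos_real`; N510 `chebyshevC_derivative_eq_S`, `chebyshevC_derivative_eval_two`; `Literature…RootDragging.eval_derivative_prod_X_sub_C`;
`Literature…PolynomialLatticeDiscrepancy.sum_inv_sin_sq_eq` (the `csc²` form, cited); Mathlib `derivative_U_eval_one`, `S_comp_two_mul_X`, `derivative_comp`, `Real.cos_eq_one_iff_of_lt_of_lt`.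
THIS FILE (namespace `Summit.Ventures.HSemireg.Wedge.HankelOuter` continued; CHAINED on N512; 0 definitions):
* §1278 `eval_derivative_of_eq_X_sub_C_mul` (`p'(a) = q(a)`, `p''(a) = 2q'(a)`), **`six_mul_derivative_S_eval_two`** (`6S_m'(2) = m(m+1)(m+2)`), **`six_mul_derivative_two_C_eval_two`**
  (`6C_n''(2) = n²(n²−1)`), `chebyshevC_sub_two_eq_X_sub_C_mul_prod`, **`sum_inv_two_sub_two_mul_cos_eq`** (`∑_{j=1}^{n−1} 1∕(2 − 2cos(2πj∕n)) = (n²−1)∕12`; with `2 − 2cos 2α = 4sin² α` this is the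
  cited cosecant sum).
CAVEATS.  `n ≥ 1` (the sums are empty for `n = 1`); sums over `j ∈ [1, n−1]` are written over `Finset.range (n − 1)` with the shift `j + 1`.  Nothing Ext-side.  New names only.
-/

open Module Polynomial
open scoped Matrix Polynomial

namespace Summit.Ventures.HSemireg.Wedge.HankelOuter

/-! ## §1278. The cosecant-square sum -/

/-- At a split-off linear factor: **`p = (X − a)q ⇒ p'(a) = q(a)` and `p''(a) = 2q'(a)`**. [folklore; this file, §1278] -/
theorem eval_derivative_of_eq_X_sub_C_mul {K : Type*} [CommRing K] {p q : K[X]} {a : K} (h : p = (Polynomial.X - Polynomial.C a) * q) :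
    (derivative p).eval a = q.eval a ∧ (derivative (derivative p)).eval a = 2 * (derivative q).eval a := by
  subst h
  constructor
  · rw [derivative_mul, derivative_X_sub_C, one_mul, eval_add, eval_mul, eval_sub, eval_X, eval_C, sub_self, zero_mul, add_zero]
  · rw [derivative_mul, derivative_X_sub_C, one_mul, derivative_add, derivative_mul, derivative_X_sub_C, one_mul, eval_add, eval_add, eval_mul, eval_sub, eval_X, eval_C, sub_self,
      zero_mul, add_zero, two_mul]

/-- **`6 S_m'(2) = m(m+1)(m+2)`** (all `m ∈ ℤ`, every commutative ring; `S_m(2x) = U_m(x)` and Mathlib's `3U_m'(1) = m(m+1)(m+2)`). [Rivlin (1.98); this file, §1278] -/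
theorem six_mul_derivative_S_eval_two {R : Type*} [CommRing R] (m : ℤ) :
    6 * (derivative (Polynomial.Chebyshev.S R m)).eval 2 = ((m : R) + 2) * ((m : R) + 1) * (m : R) := by
  have h := congrArg (fun p : R[X] => (derivative p).eval 1) (Polynomial.Chebyshev.S_comp_two_mul_X R m)
  have h2 : derivative (2 * Polynomial.X : R[X]) = 2 := by rw [derivative_mul, derivative_X, mul_one, derivative_ofNat, zero_mul, zero_add]
  simp only [derivative_comp, h2, eval_mul, eval_ofNat, eval_comp, eval_X, mul_one] at h
  have hU := Polynomial.Chebyshev.derivative_U_eval_one (R := R) m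
  rw [← h] at hU
  linear_combination hU

/-- **`6 C_n''(2) = n²(n² − 1)`** (all `n ∈ ℤ`, every commutative ring). [Rivlin (1.97)–(1.98) (dilated); this file, §1278] -/
theorem six_mul_derivative_two_C_eval_two {R : Type*} [CommRing R] (n : ℤ) :
    6 * (derivative (derivative (Polynomial.Chebyshev.C R n))).eval 2 = (n : R) ^ 2 * ((n : R) ^ 2 - 1) := by
  rw [chebyshevC_derivative_eq_S, derivative_mul, derivative_intCast, zero_mul, zero_add, eval_mul, eval_intCast]
  have h := six_mul_derivative_S_eval_two (R := R) (n - 1)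
  push_cast at h
  linear_combination (n : R) * h

/-- `C_{m+1} − 2 = (X − 2) · ∏_{j<m} (X − 2cos(2π(j+1)∕(m+1)))` over `ℝ` (N508 with the root `2` split off). [this file, §1278] -/
theorem chebyshevC_sub_two_eq_X_sub_C_mul_prod (m : ℕ) :
    Polynomial.Chebyshev.C ℝ ((m + 1 : ℕ) : ℤ) - 2 = (Polynomial.X - Polynomial.C 2) * ∏ j ∈ Finset.range m, (Polynomial.X - Polynomial.C (2 * Real.cos ((j + 1 : ℕ) * (2 * Real.pi / (m + 1 : ℕ))))) := by
  rw [chebyshevC_sub_two_eq_prod_cos_real (Nat.succ_ne_zero m), Finset.prod_range_succ', Nat.cast_zero, zero_mul, Real.cos_zero, mul_one, mul_comm]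

/-- **`∑_{j=1}^{n−1} 1∕(2 − 2cos(2πj∕n)) = (n² − 1)∕12`** (`n ≥ 1`; logarithmic derivative of `(C_n − 2)∕(X − 2)` at `2`). [Gradshteyn–Ryzhik 1.382; this file, §1278] -/
theorem sum_inv_two_sub_two_mul_cos_eq {n : ℕ} (hn : n ≠ 0) : ∑ j ∈ Finset.range (n - 1), 1 / (2 - 2 * Real.cos ((j + 1 : ℕ) * (2 * Real.pi / n))) = ((n : ℝ) ^ 2 - 1) / 12 := by
  obtain ⟨m, rfl⟩ := Nat.exists_eq_add_one_of_ne_zero hn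
  rw [Nat.add_sub_cancel]
  set Q : ℝ[X] := ∏ j ∈ Finset.range m, (Polynomial.X - Polynomial.C (2 * Real.cos ((j + 1 : ℕ) * (2 * Real.pi / (m + 1 : ℕ))))) with hQ
  obtain ⟨h1, h2⟩ := eval_derivative_of_eq_X_sub_C_mul (chebyshevC_sub_two_eq_X_sub_C_mul_prod m)
  rw [derivative_sub, derivative_ofNat, sub_zero, chebyshevC_derivative_eval_two] at h1
  rw [derivative_sub, derivative_ofNat, sub_zero] at h2
  have h6 := six_mul_derivative_two_C_eval_two (R := ℝ) (((m + 1 : ℕ)) : ℤ)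
  rw [h2, Int.cast_natCast] at h6
  -- `Q'(2) = Q(2) Σ 1/(2 − r_j)` with `2 ≠ r_j`
  have hne : ∀ j ∈ Finset.range m, (2 : ℝ) ≠ 2 * Real.cos ((j + 1 : ℕ) * (2 * Real.pi / (m + 1 : ℕ))) := fun j hj h => by
    have hj := Finset.mem_range.mp hj
    have hθpos : 0 < ((j + 1 : ℕ) : ℝ) * (2 * Real.pi / (m + 1 : ℕ)) := by positivity
    have hθlt : ((j + 1 : ℕ) : ℝ) * (2 * Real.pi / (m + 1 : ℕ)) < 2 * Real.pi := by
      rw [mul_div_assoc', div_lt_iff₀ (by positivity)]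
      have : ((j + 1 : ℕ) : ℝ) < ((m + 1 : ℕ) : ℝ) := by exact_mod_cast (by omega : j + 1 < m + 1)
      nlinarith [Real.pi_pos]
    have hcos : Real.cos (((j + 1 : ℕ) : ℝ) * (2 * Real.pi / (m + 1 : ℕ))) = 1 := by linarith
    exact hθpos.ne' ((Real.cos_eq_one_iff_of_lt_of_lt (by linarith) hθlt).mp hcos)
  have hlog := Literature.Algebra.Polynomial.RootDragging.eval_derivative_prod_X_sub_C (Finset.range m) (fun j : ℕ => 2 * Real.cos ((j + 1 : ℕ) * (2 * Real.pi / (m + 1 : ℕ)))) hne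
  rw [← hQ, ← h1] at hlog
  have hn2 : (((m + 1 : ℕ) : ℝ)) ^ 2 ≠ 0 := by positivity
  have key : (((m + 1 : ℕ) : ℝ)) ^ 2 * ∑ j ∈ Finset.range m, 1 / ((2 : ℝ) - 2 * Real.cos ((j + 1 : ℕ) * (2 * Real.pi / (m + 1 : ℕ)))) = (((m + 1 : ℕ) : ℝ)) ^ 2 * (((((m + 1 : ℕ) : ℝ)) ^ 2 - 1) / 12) := by
    linear_combination (-1 : ℝ) * hlog + h6 / 12
  exact mul_left_cancel₀ hn2 key

end Summit.Ventures.HSemireg.Wedge.HankelOuter
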